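import Literature.MathematicalPhysics.QuantumLattice.HubbardWave0RayleighProofs
import HarnessLib

/-!
# Pair annihilators see the charge carriers: the core Cauchy–Schwarz estimate

Proof-only toolkit, part I, behind the carrier bound of `PairFieldCarrierBoundAssembly` ("no pair-field order without holes or
doublons"). Setting: the Jordan–Wigner Fock space `Fock ι = Finset ι → ℂ` of `HubbardWave0`, a
finite family of elementary pair annihilators `T_j = c_{a_j} c_{b_j}` (`j : J`, `a_j ≠ b_j`),
weights `w_j ∈ ℂ`, and for each `j` a "partner" orbital `o_j ≠ a_j` (on a Hubbard lattice: `a_j`,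
`o_j` are the two spin-orbitals of one site `x_j`, and `b_j` sits on a neighbouring site). For a
Fock vector `ψ` write `H_j = Σ_{t : a_j, o_j ∉ t} |ψ t|²` (weight of a HOLE at `x_j`) and
`D_j = Σ_{t : a_j, o_j ∈ t} |ψ t|²` (weight of a DOUBLON at `x_j`). The pair `(j, j')` is FAR if
`{a_j, b_j} ∩ {a_{j'}, o_{j'}} = ∅` and `{a_{j'}, b_{j'}} ∩ {a_j, o_j} = ∅`.

* `norm_sq_pairTerm_apply` — `|(T_j ψ)(s)|² = [a_j, b_j ∉ s] |ψ (s ∪ {a_j, b_j})|²`;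
* `sum_ite_norm_sq_insert_insert_le` — the reindexing `s ↦ s ∪ {a, b}` is injective on
  `{s : a, b ∉ s}`, so indicator-weighted sums of `|ψ (s ∪ {a,b})|²` are bounded by sums of `|ψ t|²`;
* `sum_norm_sq_doublonPart_le` — the DOUBLON channel (output configurations `s ∋ o_j`):
  `Σ_s |Σ_j w_j [o_j ∈ s] (T_j ψ)(s)|² ≤ ‖w‖² Σ_j D_j` (pointwise Cauchy–Schwarz in `j`; the parent
  configuration `s ∪ {a_j, b_j}` carries a doublon at `x_j`);
* `sum_norm_holeTerm_mul_le` — the HOLE channel (`s ∌ o_j`, so `x_j` is empty in `s`), one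
  pair of terms: `Σ_s |v_j(s)| |v_{j'}(s)| ≤ √H_{j'} √H_j + [¬ far] ‖ψ‖²` — for a far pair the hole
  at `x_{j'}` in `s` survives in `s ∪ {a_j, b_j}` (Cauchy–Schwarz with crossed indicators,
  `sum_ite_hole_norm_sq_holeTerm_le`), and any pair is bounded by `‖ψ‖²`.

The assembly (hole channel summed over pairs, and the final carrier bound
`Σ_s |Σ_j w_j (T_j ψ)(s)|² ≤ 2 ‖w‖² (Σ_j D_j + Σ_j H_j + D ‖ψ‖²)`) is in
`PairFieldCarrierBoundAssembly.lean`.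

This is elementary (finite sums, Cauchy–Schwarz); it is the kinematic kernel of the statement that
the pair-field order parameter of a doped Mott insulator is controlled by the carrier density
(cf. the Gutzwiller factors of Zhang–Gross–Rice–Shiba, Supercond. Sci. Technol. 1 (1988) 36, §2,
and Yang's kinematic bound, Rev. Mod. Phys. 34 (1962) 694, §3). Folklore; no definition, no named
fact is introduced.
-/

namespace Literature.MathematicalPhysics.QuantumLattice

namespace PairFieldCarrier

open Matrix Finset RayleighBound

variable {ι : Type*} [LinearOrder ι] [Fintype ι]

/-! ### One elementary pair annihilator in coordinates -/

/-- **`|(c_a c_b ψ)(s)|² = [a ∉ s][b ∉ s] |ψ (s ∪ {a, b})|²`** for `a ≠ b` (the Jordan–Wigner signs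
have modulus one). Bratteli–Robinson II §5.2.2. [folklore] -/
theorem norm_sq_pairTerm_apply {a b : ι} (hab : a ≠ b) (ψ : Fock ι) (s : Finset ι) :
    ‖((annihilation a * annihilation b) *ᵥ ψ) s‖ ^ 2 =
      if a ∉ s ∧ b ∉ s then ‖ψ (insert b (insert a s))‖ ^ 2 else 0 := by
  rw [annihilation_mul_annihilation_mulVec_apply]
  by_cases h : a ∉ s ∧ b ∉ s
  · rw [if_pos ⟨h.1, h.2, hab⟩, if_pos h, norm_mul, norm_mul, norm_jwSign, norm_jwSign]
    ring
  · rw [if_neg (fun h' => h ⟨h'.1, h'.2.1⟩), if_neg h]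
    simp

/-- Restricting by an indicator: `|[P] z|² = [P] |z|²`. [folklore] -/
theorem norm_sq_ite_mul (P : Prop) [Decidable P] (z : ℂ) :
    ‖(if P then (1 : ℂ) else 0) * z‖ ^ 2 = if P then ‖z‖ ^ 2 else 0 := by
  split_ifs <;> simp

/-- **Injective reindexing.** For `a ≠ b`, nonnegative `F` and predicates with
`P s → Q (s ∪ {a, b})` whenever `a, b ∉ s`:
`Σ_s [a ∉ s ∧ b ∉ s ∧ P s] F (s ∪ {a,b}) ≤ Σ_t [Q t] F t` (the map `s ↦ s ∪ {a, b}` is injective on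
`{s : a, b ∉ s}`). [folklore] -/
theorem sum_ite_insert_insert_le {a b : ι} (hab : a ≠ b) {F : Finset ι → ℝ} (hF : ∀ t, 0 ≤ F t)
    (P Q : Finset ι → Prop) [DecidablePred P] [DecidablePred Q]
    (hPQ : ∀ s, a ∉ s → b ∉ s → P s → Q (insert b (insert a s))) :
    (∑ s : Finset ι, if a ∉ s ∧ b ∉ s ∧ P s then F (insert b (insert a s)) else 0) ≤
      ∑ t : Finset ι, if Q t then F t else 0 := by
  classical
  set S : Finset (Finset ι) := Finset.univ.filter fun s => a ∉ s ∧ b ∉ s ∧ P s with hS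
  set e : Finset ι → Finset ι := fun s => insert b (insert a s) with he
  have hinj : Set.InjOn e ↑S := by
    intro s hs s' hs' h
    have hs1 := (Finset.mem_filter.1 (Finset.mem_coe.1 hs)).2
    have hs2 := (Finset.mem_filter.1 (Finset.mem_coe.1 hs')).2
    have key : ∀ u : Finset ι, a ∉ u → b ∉ u → ((insert b (insert a u)).erase b).erase a = u := by
      intro u hau hbu
      rw [Finset.erase_insert (by simp [hbu, hab.symm]), Finset.erase_insert hau]
    have := congrArg (fun u => (u.erase b).erase a) h
    simp only [he] at this
    rwa [key s hs1.1 hs1.2.1, key s' hs2.1 hs2.2.1] at this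
  calc (∑ s : Finset ι, if a ∉ s ∧ b ∉ s ∧ P s then F (insert b (insert a s)) else 0)
      = ∑ s ∈ S, F (e s) := by
        rw [← Finset.sum_filter]
    _ = ∑ t ∈ S.image e, F t := (Finset.sum_image hinj).symm
    _ ≤ ∑ t ∈ Finset.univ.filter fun t => Q t, F t := by
        apply Finset.sum_le_sum_of_subset_of_nonneg
        · intro t ht
          obtain ⟨s, hs, rfl⟩ := Finset.mem_image.1 ht
          have hs' := (Finset.mem_filter.1 hs).2
          exact Finset.mem_filter.2 ⟨Finset.mem_univ _, hPQ s hs'.1 hs'.2.1 hs'.2.2⟩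
        · exact fun t _ _ => hF t
    _ = ∑ t : Finset ι, if Q t then F t else 0 := by rw [← Finset.sum_filter]

/-- The total weight of one (indicator-restricted) pair term is at most `‖ψ‖²`:
`Σ_s [P s] |(c_a c_b ψ)(s)|² ≤ Σ_t |ψ t|²`. [folklore] -/
theorem sum_ite_norm_sq_pairTerm_le {a b : ι} (hab : a ≠ b) (ψ : Fock ι)
    (P : Finset ι → Prop) [DecidablePred P] :
    (∑ s : Finset ι, if P s then ‖((annihilation a * annihilation b) *ᵥ ψ) s‖ ^ 2 else 0) ≤
      ∑ t : Finset ι, ‖ψ t‖ ^ 2 := by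
  classical
  have h := sum_ite_insert_insert_le hab (F := fun t => ‖ψ t‖ ^ 2) (fun t => by positivity)
    P (fun _ => True) (fun _ _ _ _ => trivial)
  simp only [if_true] at h
  refine le_trans (le_of_eq (Finset.sum_congr rfl fun s _ => ?_)) h
  rw [norm_sq_pairTerm_apply hab]
  by_cases hP : P s <;> by_cases hs : a ∉ s ∧ b ∉ s <;> simp [hP, hs]

/-! ### Elementary real inequalities -/

/-- `‖Σ_j c_j‖² ≤ Σ_{j,j'} ‖c_j‖ ‖c_{j'}‖`. [folklore] -/
theorem norm_sum_sq_le_sum_sum {J : Type*} (s : Finset J) (c : J → ℂ) :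
    ‖∑ j ∈ s, c j‖ ^ 2 ≤ ∑ j ∈ s, ∑ j' ∈ s, ‖c j‖ * ‖c j'‖ := by
  calc ‖∑ j ∈ s, c j‖ ^ 2 ≤ (∑ j ∈ s, ‖c j‖) ^ 2 :=
        pow_le_pow_left₀ (norm_nonneg _) (norm_sum_le _ _) 2
    _ = ∑ j ∈ s, ∑ j' ∈ s, ‖c j‖ * ‖c j'‖ := by rw [sq, Finset.sum_mul_sum]

/-- Pointwise Cauchy–Schwarz in the family index: `‖Σ_j w_j z_j‖² ≤ (Σ_j ‖w_j‖²) (Σ_j ‖z_j‖²)`. [folklore] -/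
theorem norm_sum_mul_sq_le {J : Type*} (s : Finset J) (w z : J → ℂ) :
    ‖∑ j ∈ s, w j * z j‖ ^ 2 ≤ (∑ j ∈ s, ‖w j‖ ^ 2) * ∑ j ∈ s, ‖z j‖ ^ 2 := by
  calc ‖∑ j ∈ s, w j * z j‖ ^ 2 ≤ (∑ j ∈ s, ‖w j‖ * ‖z j‖) ^ 2 := by
        refine pow_le_pow_left₀ (norm_nonneg _) ((norm_sum_le _ _).trans (le_of_eq ?_)) 2
        exact Finset.sum_congr rfl fun j _ => norm_mul _ _
    _ ≤ (∑ j ∈ s, ‖w j‖ ^ 2) * ∑ j ∈ s, ‖z j‖ ^ 2 := Finset.sum_mul_sq_le_sq_mul_sq _ _ _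

/-- Cauchy–Schwarz for a sum of products of reals, in square-root form:
`Σ_s f s g s ≤ √(Σ f²) √(Σ g²)`. [folklore] -/
theorem sum_mul_le_sqrt_mul_sqrt {α : Type*} (s : Finset α) (f g : α → ℝ) :
    ∑ i ∈ s, f i * g i ≤ Real.sqrt (∑ i ∈ s, f i ^ 2) * Real.sqrt (∑ i ∈ s, g i ^ 2) := by
  rw [← Real.sqrt_mul (Finset.sum_nonneg fun i _ => sq_nonneg (f i))]
  exact (le_abs_self _).trans (Real.abs_le_sqrt (Finset.sum_mul_sq_le_sq_mul_sq s f g))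

/-! ### The two channels -/

section Channels

variable {J : Type*} [Fintype J] (a b o : J → ι) (w : J → ℂ) (ψ : Fock ι)

omit [Fintype J] in
/-- The doublon-channel summand of one term, in closed form: restricting `(c_{a_j} c_{b_j} ψ)(s)` to
output configurations `s ∋ o_j` leaves `[a_j, b_j ∉ s, o_j ∈ s] |ψ (s ∪ {a_j, b_j})|²`. [folklore] -/
theorem ite_mem_norm_sq_pairTerm (hab : ∀ j, a j ≠ b j) (j : J) (s : Finset ι) :
    (if o j ∈ s then ‖((annihilation (a j) * annihilation (b j)) *ᵥ ψ) s‖ ^ 2 else 0) =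
      if a j ∉ s ∧ b j ∉ s ∧ o j ∈ s then ‖ψ (insert (b j) (insert (a j) s))‖ ^ 2 else 0 := by
  rw [norm_sq_pairTerm_apply (hab j)]
  by_cases h1 : o j ∈ s <;> by_cases h2 : a j ∉ s ∧ b j ∉ s <;> simp [h1, h2]

omit [Fintype J] in
/-- The hole-channel summand of one term with an extra indicator `R`:
`[R s][o_j ∉ s] |(c_{a_j} c_{b_j} ψ)(s)|² = [a_j, b_j ∉ s, R s ∧ o_j ∉ s] |ψ (s ∪ {a_j, b_j})|²`. [folklore] -/
theorem ite_ite_notMem_norm_sq_pairTerm (hab : ∀ j, a j ≠ b j) (j : J) (R : Finset ι → Prop)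
    [DecidablePred R] (s : Finset ι) :
    (if R s then (if o j ∉ s then ‖((annihilation (a j) * annihilation (b j)) *ᵥ ψ) s‖ ^ 2 else 0)
      else 0) =
      if a j ∉ s ∧ b j ∉ s ∧ (R s ∧ o j ∉ s) then ‖ψ (insert (b j) (insert (a j) s))‖ ^ 2 else 0 := by
  rw [norm_sq_pairTerm_apply (hab j)]
  by_cases h0 : R s <;> by_cases h1 : o j ∉ s <;> by_cases h2 : a j ∉ s ∧ b j ∉ s <;> simp [h0, h1, h2]

/-- **Doublon channel.** Restricting every term to output configurations containing the partner
orbital `o_j` (so that the PARENT configuration `s ∪ {a_j, b_j}` has a doublon `{a_j, o_j}`):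
`Σ_s |Σ_j w_j [o_j ∈ s] (c_{a_j} c_{b_j} ψ)(s)|² ≤ (Σ_j |w_j|²) · Σ_j Σ_{t ∋ a_j, o_j} |ψ t|²`
(pointwise Cauchy–Schwarz in `j`, then the injective reindexing `s ↦ s ∪ {a_j, b_j}`). [folklore] -/
theorem sum_norm_sq_doublonPart_le (hab : ∀ j, a j ≠ b j) :
    (∑ s : Finset ι, ‖∑ j, w j * ((if o j ∈ s then (1 : ℂ) else 0) *
        ((annihilation (a j) * annihilation (b j)) *ᵥ ψ) s)‖ ^ 2) ≤
      (∑ j, ‖w j‖ ^ 2) *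
        ∑ j, ∑ t : Finset ι, if a j ∈ t ∧ o j ∈ t then ‖ψ t‖ ^ 2 else 0 := by
  classical
  calc (∑ s : Finset ι, ‖∑ j, w j * ((if o j ∈ s then (1 : ℂ) else 0) *
        ((annihilation (a j) * annihilation (b j)) *ᵥ ψ) s)‖ ^ 2)
      ≤ ∑ s : Finset ι, (∑ j, ‖w j‖ ^ 2) * ∑ j, ‖(if o j ∈ s then (1 : ℂ) else 0) *
          ((annihilation (a j) * annihilation (b j)) *ᵥ ψ) s‖ ^ 2 :=
        Finset.sum_le_sum fun s _ => norm_sum_mul_sq_le _ _ _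
    _ = (∑ j, ‖w j‖ ^ 2) * ∑ j, ∑ s : Finset ι,
          if a j ∉ s ∧ b j ∉ s ∧ o j ∈ s then ‖ψ (insert (b j) (insert (a j) s))‖ ^ 2 else 0 := by
        rw [← Finset.mul_sum, Finset.sum_comm]
        congr 1
        refine Finset.sum_congr rfl fun j _ => Finset.sum_congr rfl fun s _ => ?_
        rw [norm_sq_ite_mul, ite_mem_norm_sq_pairTerm a b o ψ hab]
    _ ≤ (∑ j, ‖w j‖ ^ 2) * ∑ j, ∑ t : Finset ι, if a j ∈ t ∧ o j ∈ t then ‖ψ t‖ ^ 2 else 0 := by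
        refine mul_le_mul_of_nonneg_left (Finset.sum_le_sum fun j _ => ?_)
          (Finset.sum_nonneg fun _ _ => by positivity)
        exact sum_ite_insert_insert_le (hab j) (F := fun t => ‖ψ t‖ ^ 2) (fun t => by positivity)
          (fun s => o j ∈ s) (fun t => a j ∈ t ∧ o j ∈ t)
          fun s _ _ ho => ⟨Finset.mem_insert_of_mem (Finset.mem_insert_self _ _),
            Finset.mem_insert_of_mem (Finset.mem_insert_of_mem ho)⟩

omit [Fintype J] in
/-- One hole-channel term has total weight at most `‖ψ‖²`. [folklore] -/
theorem sum_norm_sq_holeTerm_le (hab : ∀ j, a j ≠ b j) (j : J) :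
    (∑ s : Finset ι, ‖(if o j ∉ s then (1 : ℂ) else 0) *
        ((annihilation (a j) * annihilation (b j)) *ᵥ ψ) s‖ ^ 2) ≤ ∑ t : Finset ι, ‖ψ t‖ ^ 2 := by
  classical
  simp only [norm_sq_ite_mul]
  exact sum_ite_norm_sq_pairTerm_le (hab j) ψ _

omit [Fintype J] in
/-- **Crossed indicators for a far pair.** If `{a_j, b_j}` avoids `{a_{j'}, o_{j'}}`, then the
hole-channel term `j`, restricted to output configurations with a hole at `x_{j'}`
(`a_{j'}, o_{j'} ∉ s`), has weight at most `H_{j'} = Σ_{t ∌ a_{j'}, o_{j'}} |ψ t|²`: the hole survives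
in the parent configuration `s ∪ {a_j, b_j}`. [folklore] -/
theorem sum_ite_hole_norm_sq_holeTerm_le (hab : ∀ j, a j ≠ b j) {j j' : J}
    (h1 : a j ≠ a j') (h2 : a j ≠ o j') (h3 : b j ≠ a j') (h4 : b j ≠ o j') :
    (∑ s : Finset ι, if a j' ∉ s ∧ o j' ∉ s then ‖(if o j ∉ s then (1 : ℂ) else 0) *
        ((annihilation (a j) * annihilation (b j)) *ᵥ ψ) s‖ ^ 2 else 0) ≤
      ∑ t : Finset ι, if a j' ∉ t ∧ o j' ∉ t then ‖ψ t‖ ^ 2 else 0 := by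
  classical
  simp only [norm_sq_ite_mul]
  rw [Finset.sum_congr rfl fun s _ => ite_ite_notMem_norm_sq_pairTerm a b o ψ hab j
    (fun s => a j' ∉ s ∧ o j' ∉ s) s]
  refine sum_ite_insert_insert_le (hab j) (F := fun t => ‖ψ t‖ ^ 2) (fun t => by positivity)
    (fun s => (a j' ∉ s ∧ o j' ∉ s) ∧ o j ∉ s) (fun t => a j' ∉ t ∧ o j' ∉ t) fun s _ _ hR => ?_
  obtain ⟨⟨ha', ho'⟩, -⟩ := hR
  constructor
  · simp only [Finset.mem_insert, not_or]
    exact ⟨h3.symm, h1.symm, ha'⟩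
  · simp only [Finset.mem_insert, not_or]
    exact ⟨h4.symm, h2.symm, ho'⟩

omit [Fintype J] in
/-- The overlap of two hole-channel terms: for a FAR pair it is at most `√H_{j'} · √H_j`
(Cauchy–Schwarz after inserting the crossed hole indicators, which equal one wherever the terms are
non-zero), and for ANY pair at most `‖ψ‖²` — combined:
`Σ_s |v_j(s)| |v_{j'}(s)| ≤ √H_{j'} √H_j + [¬ far] ‖ψ‖²`. [folklore] -/
theorem sum_norm_holeTerm_mul_le (hab : ∀ j, a j ≠ b j) (j j' : J) :
    (∑ s : Finset ι, ‖(if o j ∉ s then (1 : ℂ) else 0) *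
          ((annihilation (a j) * annihilation (b j)) *ᵥ ψ) s‖ *
        ‖(if o j' ∉ s then (1 : ℂ) else 0) *
          ((annihilation (a j') * annihilation (b j')) *ᵥ ψ) s‖) ≤
      Real.sqrt (∑ t : Finset ι, if a j' ∉ t ∧ o j' ∉ t then ‖ψ t‖ ^ 2 else 0) *
          Real.sqrt (∑ t : Finset ι, if a j ∉ t ∧ o j ∉ t then ‖ψ t‖ ^ 2 else 0) +
        (if (a j ≠ a j' ∧ a j ≠ o j' ∧ b j ≠ a j' ∧ b j ≠ o j') ∧
            (a j' ≠ a j ∧ a j' ≠ o j ∧ b j' ≠ a j ∧ b j' ≠ o j) then 0 else 1) *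
          ∑ t : Finset ι, ‖ψ t‖ ^ 2 := by
  classical
  -- abbreviations
  set v : Finset ι → ℝ := fun s => ‖(if o j ∉ s then (1 : ℂ) else 0) *
      ((annihilation (a j) * annihilation (b j)) *ᵥ ψ) s‖ with hv
  set v' : Finset ι → ℝ := fun s => ‖(if o j' ∉ s then (1 : ℂ) else 0) *
      ((annihilation (a j') * annihilation (b j')) *ᵥ ψ) s‖ with hv'
  have hv0 : ∀ s, 0 ≤ v s := fun s => norm_nonneg _
  have hv'0 : ∀ s, 0 ≤ v' s := fun s => norm_nonneg _
  have hH0 : 0 ≤ Real.sqrt (∑ t : Finset ι, if a j' ∉ t ∧ o j' ∉ t then ‖ψ t‖ ^ 2 else 0) *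
      Real.sqrt (∑ t : Finset ι, if a j ∉ t ∧ o j ∉ t then ‖ψ t‖ ^ 2 else 0) := by positivity
  have hψ0 : 0 ≤ ∑ t : Finset ι, ‖ψ t‖ ^ 2 := Finset.sum_nonneg fun _ _ => by positivity
  -- support: a non-zero hole-channel term forces a hole at its own site
  have hsupp : ∀ s, v s ≠ 0 → a j ∉ s ∧ o j ∉ s := by
    intro s hs
    by_contra hno
    apply hs
    simp only [hv]
    by_cases ho : o j ∈ s
    · simp [ho]
    · have ha : a j ∈ s := by tauto
      have hT : ((annihilation (a j) * annihilation (b j)) *ᵥ ψ) s = 0 := by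
        rw [annihilation_mul_annihilation_mulVec_apply, if_neg]
        exact fun h => h.1 ha
      simp [hT]
  have hsupp' : ∀ s, v' s ≠ 0 → a j' ∉ s ∧ o j' ∉ s := by
    intro s hs
    by_contra hno
    apply hs
    simp only [hv']
    by_cases ho : o j' ∈ s
    · simp [ho]
    · have ha : a j' ∈ s := by tauto
      have hT : ((annihilation (a j') * annihilation (b j')) *ᵥ ψ) s = 0 := by
        rw [annihilation_mul_annihilation_mulVec_apply, if_neg]
        exact fun h => h.1 ha
      simp [hT]
  change ∑ s, v s * v' s ≤ _
  by_cases hfar : (a j ≠ a j' ∧ a j ≠ o j' ∧ b j ≠ a j' ∧ b j ≠ o j') ∧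
      (a j' ≠ a j ∧ a j' ≠ o j ∧ b j' ≠ a j ∧ b j' ≠ o j)
  · rw [if_pos hfar, zero_mul, add_zero]
    -- insert the crossed indicators
    have hcross : ∀ s, v s * v' s =
        (if a j' ∉ s ∧ o j' ∉ s then v s else 0) * (if a j ∉ s ∧ o j ∉ s then v' s else 0) := by
      intro s
      by_cases hz : v s = 0
      · rw [hz]; simp
      by_cases hz' : v' s = 0
      · rw [hz']; simp
      rw [if_pos (hsupp' s hz'), if_pos (hsupp s hz)]
    rw [Finset.sum_congr rfl fun s _ => hcross s]
    refine (sum_mul_le_sqrt_mul_sqrt _ _ _).trans ?_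
    have hA : (∑ s, (if a j' ∉ s ∧ o j' ∉ s then v s else 0) ^ 2) ≤
        ∑ t : Finset ι, if a j' ∉ t ∧ o j' ∉ t then ‖ψ t‖ ^ 2 else 0 := by
      refine le_trans (le_of_eq (Finset.sum_congr rfl fun s _ => ?_))
        (sum_ite_hole_norm_sq_holeTerm_le a b o ψ hab hfar.1.1 hfar.1.2.1 hfar.1.2.2.1 hfar.1.2.2.2)
      by_cases hc : a j' ∉ s ∧ o j' ∉ s
      · rw [if_pos hc, if_pos hc]
      · rw [if_neg hc, if_neg hc]; simp
    have hB : (∑ s, (if a j ∉ s ∧ o j ∉ s then v' s else 0) ^ 2) ≤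
        ∑ t : Finset ι, if a j ∉ t ∧ o j ∉ t then ‖ψ t‖ ^ 2 else 0 := by
      refine le_trans (le_of_eq (Finset.sum_congr rfl fun s _ => ?_))
        (sum_ite_hole_norm_sq_holeTerm_le a b o ψ hab hfar.2.1 hfar.2.2.1 hfar.2.2.2.1 hfar.2.2.2.2)
      by_cases hc : a j ∉ s ∧ o j ∉ s
      · rw [if_pos hc, if_pos hc]
      · rw [if_neg hc, if_neg hc]; simp
    exact mul_le_mul (Real.sqrt_le_sqrt hA) (Real.sqrt_le_sqrt hB) (Real.sqrt_nonneg _)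
      (Real.sqrt_nonneg _)
  · rw [if_neg hfar, one_mul]
    refine le_trans ?_ (le_add_of_nonneg_left hH0)
    refine (sum_mul_le_sqrt_mul_sqrt _ _ _).trans ?_
    have h1 : Real.sqrt (∑ s, v s ^ 2) ≤ Real.sqrt (∑ t : Finset ι, ‖ψ t‖ ^ 2) :=
      Real.sqrt_le_sqrt (by simpa [hv] using sum_norm_sq_holeTerm_le a b o ψ hab j)
    have h2 : Real.sqrt (∑ s, v' s ^ 2) ≤ Real.sqrt (∑ t : Finset ι, ‖ψ t‖ ^ 2) :=
      Real.sqrt_le_sqrt (by simpa [hv'] using sum_norm_sq_holeTerm_le a b o ψ hab j')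
    calc Real.sqrt (∑ s, v s ^ 2) * Real.sqrt (∑ s, v' s ^ 2)
        ≤ Real.sqrt (∑ t : Finset ι, ‖ψ t‖ ^ 2) * Real.sqrt (∑ t : Finset ι, ‖ψ t‖ ^ 2) :=
          mul_le_mul h1 h2 (Real.sqrt_nonneg _) (Real.sqrt_nonneg _)
      _ = ∑ t : Finset ι, ‖ψ t‖ ^ 2 := Real.mul_self_sqrt hψ0

end Channels

end PairFieldCarrier

end Literature.MathematicalPhysics.QuantumLattice
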